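import Summits.AtomisticToContinuum.HydrodynamicLimit.Theorems.InfluenceLocality.Negative.TubeNoContact
import Summits.AtomisticToContinuum.HydrodynamicLimit.Theorems.InfluenceLocality.Negative.ContactPerturbation
import Literature.Analysis.FluidPDE.HardSphereTorusMeasure
import HarnessLib

/-!
# `InfluenceLocality` (stmt-AtomisticToContinuum-13916) — progress of a designed tube contact (stub `stub_tubeProg`)

Line `ignition-cascade-refutation` (lead c3), Phase 2 (construction of `IgnitionTemplates`). The phase sets of the
eventual phase script (Negative/PhaseScript.lean, `PhaseScript.TrackValid`) are FREE-FLIGHT TUBES on the flat torus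
`T3`: states `(t, y, w)` with `‖w - v‖ ≤ δv` whose back-extrapolation `y + proj ((t₀ - t) • w)` to the nominal time
`t₀` lies within `δx` (minimal-image distance `Torus.euclidDist`) of the nominal point `x`. This file discharges the
`prog` field of `PhaseScript.TrackValid` for a designed MOVER–TARGET pair of tubes: if the NOMINAL relative motion
(separation vector `S` of the two nominal free-flight points at the common time `t`, relative velocity
`u₀ = v₁ - v₂`) reaches contact distance `ε` after time `s₀` with incoming margin `κ`, and the tube tolerances are
small against `D < κ² ε / 4`, then two actual tube states overlap (minimal-image distance `< ε`) after a free flight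
of duration `σ = s₀ + 2D/(κ‖u₀‖)`. The Euclidean core is `contactPerturbation_overlap`
(Negative/ContactPerturbation.lean); the torus enters only through the chart of the minimal image
(`Torus.sepVec_translate_of_norm_lt`), valid because everything happens at minimal-image scale `< 1/2`.
Design-independent; asserts no Theses decl.
-/

namespace Summit.AtomisticToContinuum.HydrodynamicLimit.Theorems.InfluenceLocality.Negative

open MeasureTheory Set
open scoped InnerProductSpace
open Literature.Analysis.FluidPDE Literature.MathematicalPhysics.KineticTheory
open Literature.Analysis.FunctionSpaces

noncomputable section

/-- PROGRESS OF A DESIGNED TUBE CONTACT. Two tube states `(t, y₁, w₁)`, `(t, y₂, w₂)` at a common time `t` (tube `i`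
with nominal data `(tᵢ, xᵢ, vᵢ)` and tolerances `(δxᵢ, δvᵢ)`: `‖wᵢ - vᵢ‖ ≤ δvᵢ` and the back-extrapolated position
`yᵢ + proj ((tᵢ - t) • wᵢ)` is within `δxᵢ` of `xᵢ`). Let `S` be the torus separation vector of the nominal points
`pᵢ = xᵢ + proj ((t - tᵢ) • vᵢ)`, `u₀ = v₁ - v₂ ≠ 0`, and suppose the nominal relative free motion reaches contact at
time `s₀ ≥ 0`, `‖S + s₀ • u₀‖ = ε`, incoming with margin `κ`, `⟪S + s₀ • u₀, u₀⟫ ≤ -κ ε ‖u₀‖`. If the enclosure radii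
`rᵢ = δxᵢ + |t - tᵢ| δvᵢ` and velocity tolerances satisfy `(r₁ + r₂) + σ (δv₁ + δv₂) ≤ D` with `0 < D < κ² ε / 4`,
`σ = s₀ + 2D/(κ‖u₀‖)`, and the whole configuration stays at minimal-image scale
(`‖S‖ + (r₁ + r₂) + σ (‖u₀‖ + δv₁ + δv₂) < 1/2`), then after the free flight of duration `σ` the two states overlap:
`euclidDist (y₁ + proj (σ • w₁)) (y₂ + proj (σ • w₂)) < ε`. Proof: by `stub_tubeEnclosure`, `yᵢ = pᵢ + proj aᵢ` with
`‖aᵢ‖ ≤ rᵢ` (`aᵢ = reprSym (yᵢ - pᵢ)`); by the chart `Torus.sepVec_translate_of_norm_lt`,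
`sepVec y₁ y₂ = S + (a₁ - a₂)`; `contactPerturbation_overlap` (with `q₀ = S`, `q = S + (a₁ - a₂)`, `u = w₁ - w₂`,
`t₀ = s₀`) gives `‖sepVec y₁ y₂ + σ • (w₁ - w₂)‖ < ε`; and the chart again identifies the left-hand side with the
minimal-image distance of the two translated states. -/
theorem stub_tubeProg :
    ∀ (ε κ D s₀ t₁ t₂ t : ℝ) (x₁ x₂ y₁ y₂ : T3) (v₁ v₂ w₁ w₂ : V3) (δx₁ δv₁ δx₂ δv₂ : ℝ),
    0 < ε → 0 < κ → κ ≤ 1 → 0 < D → D < κ ^ 2 * ε / 4 → 0 ≤ s₀ → v₁ - v₂ ≠ 0 → 0 ≤ δv₁ → 0 ≤ δv₂ →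
    ‖w₁ - v₁‖ ≤ δv₁ → Torus.euclidDist (y₁ + Torus.proj ((t₁ - t) • w₁)) x₁ ≤ δx₁ →
    ‖w₂ - v₂‖ ≤ δv₂ → Torus.euclidDist (y₂ + Torus.proj ((t₂ - t) • w₂)) x₂ ≤ δx₂ →
    ‖(Torus.geometry (Fin 3)).sepVec (x₁ + Torus.proj ((t - t₁) • v₁)) (x₂ + Torus.proj ((t - t₂) • v₂))
        + s₀ • (v₁ - v₂)‖ = ε →
    ⟪(Torus.geometry (Fin 3)).sepVec (x₁ + Torus.proj ((t - t₁) • v₁)) (x₂ + Torus.proj ((t - t₂) • v₂))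
        + s₀ • (v₁ - v₂), v₁ - v₂⟫_ℝ ≤ -(κ * ε * ‖v₁ - v₂‖) →
    ((δx₁ + |t - t₁| * δv₁) + (δx₂ + |t - t₂| * δv₂))
        + (s₀ + 2 * D / (κ * ‖v₁ - v₂‖)) * (δv₁ + δv₂) ≤ D →
    ‖(Torus.geometry (Fin 3)).sepVec (x₁ + Torus.proj ((t - t₁) • v₁)) (x₂ + Torus.proj ((t - t₂) • v₂))‖
        + ((δx₁ + |t - t₁| * δv₁) + (δx₂ + |t - t₂| * δv₂))
        + (s₀ + 2 * D / (κ * ‖v₁ - v₂‖)) * (‖v₁ - v₂‖ + (δv₁ + δv₂)) < 1 / 2 →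
    Torus.euclidDist (y₁ + Torus.proj ((s₀ + 2 * D / (κ * ‖v₁ - v₂‖)) • w₁))
        (y₂ + Torus.proj ((s₀ + 2 * D / (κ * ‖v₁ - v₂‖)) • w₂)) < ε := by
  intro ε κ D s₀ t₁ t₂ t x₁ x₂ y₁ y₂ v₁ v₂ w₁ w₂ δx₁ δv₁ δx₂ δv₂ hε hκ hκ1 hD hDsmall hs₀ hu₀ hδv₁ hδv₂
    hw₁ hy₁ hw₂ hy₂ hcontact hin hdev hchart
  -- abbreviations: nominal points `pᵢ`, enclosure radii `rᵢ`, nominal separation `S`, relative velocity `u₀`,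
  -- flight duration `σ`
  set p₁ : T3 := x₁ + Torus.proj ((t - t₁) • v₁) with hp₁
  set p₂ : T3 := x₂ + Torus.proj ((t - t₂) • v₂) with hp₂
  set r₁ : ℝ := δx₁ + |t - t₁| * δv₁ with hr₁
  set r₂ : ℝ := δx₂ + |t - t₂| * δv₂ with hr₂
  set S : V3 := (Torus.geometry (Fin 3)).sepVec p₁ p₂ with hS
  set u₀ : V3 := v₁ - v₂ with hu₀_def
  set σ : ℝ := s₀ + 2 * D / (κ * ‖u₀‖) with hσ
  -- signs
  have hL0 : 0 < ‖u₀‖ := norm_pos_iff.mpr hu₀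
  have hκL : 0 < κ * ‖u₀‖ := mul_pos hκ hL0
  have hσ0 : 0 ≤ σ := add_nonneg hs₀ (div_nonneg (by linarith) hκL.le)
  -- tube enclosures: `yᵢ` is within `rᵢ` of `pᵢ`
  have h₁ : Torus.euclidDist y₁ p₁ ≤ r₁ := stub_tubeEnclosure t₁ t x₁ y₁ v₁ w₁ δx₁ δv₁ hw₁ hy₁
  have h₂ : Torus.euclidDist y₂ p₂ ≤ r₂ := stub_tubeEnclosure t₂ t x₂ y₂ v₂ w₂ δx₂ δv₂ hw₂ hy₂
  -- minimal-image displacements `aᵢ` with `yᵢ = pᵢ + proj aᵢ`, `‖aᵢ‖ ≤ rᵢ`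
  set a₁ : V3 := Torus.reprSym (y₁ - p₁) with ha₁
  set a₂ : V3 := Torus.reprSym (y₂ - p₂) with ha₂
  have ha₁n : ‖a₁‖ ≤ r₁ := by rwa [ha₁, ← Torus.euclidDist_eq]
  have ha₂n : ‖a₂‖ ≤ r₂ := by rwa [ha₂, ← Torus.euclidDist_eq]
  have hy₁eq : y₁ = (Torus.geometry (Fin 3)).translate p₁ a₁ := by
    rw [Torus.geometry_translate, ha₁, Torus.proj_reprSym, add_sub_cancel]
  have hy₂eq : y₂ = (Torus.geometry (Fin 3)).translate p₂ a₂ := by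
    rw [Torus.geometry_translate, ha₂, Torus.proj_reprSym, add_sub_cancel]
  have ha₁₂ : ‖a₁ - a₂‖ ≤ r₁ + r₂ := (norm_sub_le a₁ a₂).trans (add_le_add ha₁n ha₂n)
  -- the dropped terms of the chart hypothesis are nonnegative
  have hσu : 0 ≤ σ * (‖u₀‖ + (δv₁ + δv₂)) := mul_nonneg hσ0 (by positivity)
  have hσδ : 0 ≤ σ * (δv₁ + δv₂) := mul_nonneg hσ0 (by positivity)
  -- chart 1: the actual separation vector is the nominal one plus `a₁ - a₂`
  have hq : (Torus.geometry (Fin 3)).sepVec y₁ y₂ = S + (a₁ - a₂) := by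
    rw [hy₁eq, hy₂eq]
    refine Torus.sepVec_translate_of_norm_lt ?_
    linarith
  -- relative velocity `u = w₁ - w₂` is within `δv₁ + δv₂` of `u₀`
  have hu : ‖(w₁ - w₂) - u₀‖ ≤ δv₁ + δv₂ := by
    have : (w₁ - w₂) - u₀ = (w₁ - v₁) - (w₂ - v₂) := by rw [hu₀_def]; abel
    rw [this]
    exact (norm_sub_le _ _).trans (add_le_add hw₁ hw₂)
  -- Euclidean core: overlap of the perturbed relative motion at time `σ`
  have hdev' : ‖((Torus.geometry (Fin 3)).sepVec y₁ y₂ - S) + σ • ((w₁ - w₂) - u₀)‖ ≤ D := by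
    rw [hq, add_sub_cancel_left]
    calc ‖(a₁ - a₂) + σ • ((w₁ - w₂) - u₀)‖ ≤ ‖a₁ - a₂‖ + ‖σ • ((w₁ - w₂) - u₀)‖ := norm_add_le _ _
      _ = ‖a₁ - a₂‖ + σ * ‖(w₁ - w₂) - u₀‖ := by rw [norm_smul, Real.norm_eq_abs, abs_of_nonneg hσ0]
      _ ≤ (r₁ + r₂) + σ * (δv₁ + δv₂) := add_le_add ha₁₂ (mul_le_mul_of_nonneg_left hu hσ0)
      _ ≤ D := hdev
  have hover : ‖(Torus.geometry (Fin 3)).sepVec y₁ y₂ + σ • (w₁ - w₂)‖ < ε :=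
    contactPerturbation_overlap hε hκ hκ1 hu₀ hcontact hin hD hDsmall hdev'
  -- chart 2: the separation vector after the free flight of duration `σ`
  have hwn : ‖σ • w₁ - σ • w₂‖ ≤ σ * (‖u₀‖ + (δv₁ + δv₂)) := by
    rw [← smul_sub, norm_smul, Real.norm_eq_abs, abs_of_nonneg hσ0]
    refine mul_le_mul_of_nonneg_left ?_ hσ0
    have : w₁ - w₂ = u₀ + ((w₁ - w₂) - u₀) := by abel
    rw [this]
    exact (norm_add_le _ _).trans (by linarith)
  have hqn : ‖(Torus.geometry (Fin 3)).sepVec y₁ y₂‖ ≤ ‖S‖ + (r₁ + r₂) := by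
    rw [hq]
    exact (norm_add_le _ _).trans (by linarith)
  have hfl : (Torus.geometry (Fin 3)).sepVec ((Torus.geometry (Fin 3)).translate y₁ (σ • w₁))
      ((Torus.geometry (Fin 3)).translate y₂ (σ • w₂)) =
      (Torus.geometry (Fin 3)).sepVec y₁ y₂ + (σ • w₁ - σ • w₂) :=
    Torus.sepVec_translate_of_norm_lt (by linarith)
  rw [Torus.geometry_translate, Torus.geometry_translate, ← smul_sub] at hfl
  rw [← Torus.norm_geometry_sepVec, hfl]
  exact hover

end

end Summit.AtomisticToContinuum.HydrodynamicLimit.Theorems.InfluenceLocality.Negative
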